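import Mathlib.Analysis.SpecialFunctions.Pow.Real
import HarnessLib

/-!
# Cell abc-stewartyu, crux `Y07Odd` (stmt-ABC-19658): the cell constant `cY07 = 2^110` (route-holder ruling R21-c FINAL, 2026-08-27T04:50Z)

`Summits/ABC/StewartYu/PadicG3Const.lean` — cell `abc-stewartyu` (seat p2-g4).  The growth constant of the Gen-3 odd-`p` engine text (`C m = cY07^m`):
it must dominate the construction (the `|Λ|`-branches of the k-steps and half-steps are paid by the negated bound `U·log p > cY07ⁿ·(p/log p)·∏V·W⁺`;
HOME/p2/AUDIT-IneqPackR.md and the route holder's const kit), uniform with the `p = 2` closer's `2^{110·n}`.  One definition and its trivial bounds.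
-/

noncomputable section

namespace Summit.ABC.StewartYu

/-- **The cell constant** `cY07 = 2^110`. [folklore] -/
def cY07 : ℝ := (2 : ℝ) ^ 110

/-- `cY07 = 2^110`. [folklore] -/
theorem cY07_eq : cY07 = (2 : ℝ) ^ 110 := rfl

/-- `256 ≤ cY07`. [folklore] -/
theorem le_cY07 : (256 : ℝ) ≤ cY07 := by rw [cY07_eq]; norm_num

/-- `1 ≤ cY07`. [folklore] -/
theorem one_le_cY07 : (1 : ℝ) ≤ cY07 := le_trans (by norm_num) le_cY07

/-- `0 < cY07`. [folklore] -/
theorem cY07_pos : (0 : ℝ) < cY07 := lt_of_lt_of_le (by norm_num) le_cY07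

end Summit.ABC.StewartYu

end
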